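import Mathlib.Analysis.Calculus.Deriv.Basic
import Mathlib.Topology.MetricSpace.Pseudo.Defs
import Mathlib.Order.ConditionallyCompleteLattice.Basic
import Literature.Analysis.FluidPDE.FiniteFourierModeEulerSIP

/-!
# Kishimoto–Yoneda: choosing a time interval on which the Fourier support is constant

Support file for `FiniteFourierModeEuler` (N. Kishimoto, T. Yoneda, J. Math. Fluid Mech. 24
(2022) 74 = arXiv:2110.08039). The paper works at times `t₀ ∈ I ∖ I₀`,
`I₀ = {t ∈ I : u_n(t) = 0 for some n ∈ S}` ((1.6)), which is discrete because the coefficients are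
real analytic in `t`. We replace real analyticity by an elementary selection, PROVED here:

* `exists_Ioo_forall_eq_zero_or_ne_zero`: for finitely many functions continuous on a non-empty
  open set `I ⊆ ℝ` there is a non-empty open interval `(c, d) ⊆ I` on which EACH of them is either
  identically zero or nowhere zero (maximise the number of non-vanishing functions at a point, then
  use continuity);
* `IsFiniteModeEulerSolution.exists_generic_Ioo`: for a finite-mode Euler solution, an interval
  `(c, d) ⊆ I` on which every mode `u_n`, `n ∈ S`, is either identically zero or nowhere zero, and
  the same for finitely many prescribed linear images `L (u_n)` (used with the normal / in-plane
  components in the planar case of Thm. 1.4);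
* `IsFiniteModeEulerSolution.restrict`: on such an interval the non-vanishing modes form again a
  finite-mode Euler solution (Def. 1.1 + (1.3)) whose Fourier support is EXACTLY the set of occupied
  modes at every time — the situation "`t ∈ I ∖ I₀`" of §§3–4, now valid on a whole interval.

## References

* [KishimotoYoneda2022] N. Kishimoto, T. Yoneda, J. Math. Fluid Mech. 24 (2022) 74 =
  arXiv:2110.08039, §1 (1.6) and the sentence after it ("the Fourier support of `u(t,·)` coincides
  with the set `S` if `t ∈ I ∖ I₀`").
-/

noncomputable section

open Matrix Finset Set

namespace Literature.Analysis.FluidPDE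

namespace KY

/-! ### A generic interval for finitely many continuous functions -/

/-- For finitely many functions continuous on a non-empty open subset `I` of `ℝ` with values in a
`T₁` space, there is a non-empty open interval inside `I` on which each of them is either
identically zero or nowhere zero. [folklore] -/
theorem exists_Ioo_forall_eq_zero_or_ne_zero {ι E : Type*} [TopologicalSpace E] [T1Space E] [Zero E]
    (s : Finset ι) {I : Set ℝ} (hI : IsOpen I) (hne : I.Nonempty) (g : ι → ℝ → E)
    (hg : ∀ i ∈ s, ContinuousOn (g i) I) :
    ∃ c d : ℝ, c < d ∧ Set.Ioo c d ⊆ I ∧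
      ∀ i ∈ s, (∀ t ∈ Set.Ioo c d, g i t = 0) ∨ (∀ t ∈ Set.Ioo c d, g i t ≠ 0) := by
  classical
  -- the number of non-vanishing functions at a time
  let N : ℝ → ℕ := fun t => (s.filter fun i => g i t ≠ 0).card
  have hNle : ∀ t, N t ≤ s.card := fun t => Finset.card_filter_le _ _
  -- a time maximising `N` on `I`
  have hbdd : BddAbove (N '' I) := ⟨s.card, by rintro _ ⟨t, -, rfl⟩; exact hNle t⟩
  have hne' : (N '' I).Nonempty := hne.image N
  obtain ⟨t₀, ht₀, hmax⟩ : ∃ t₀ ∈ I, ∀ t ∈ I, N t ≤ N t₀ := by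
    obtain ⟨t₀, ht₀, ht₀eq⟩ := Nat.sSup_mem hne' hbdd
    exact ⟨t₀, ht₀, fun t ht => ht₀eq ▸ le_csSup hbdd ⟨t, ht, rfl⟩⟩
  -- the open set where the functions non-vanishing at `t₀` stay non-vanishing
  set A := s.filter fun i => g i t₀ ≠ 0 with hA
  have hUopen : IsOpen (I ∩ ⋂ i ∈ A, (I ∩ g i ⁻¹' ({0} : Set E)ᶜ)) := by
    refine hI.inter (isOpen_biInter_finset fun i hi => ?_)
    have his : i ∈ s := (Finset.mem_filter.1 hi).1
    exact (hg i his).isOpen_inter_preimage hI isOpen_compl_singleton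
  have ht₀U : t₀ ∈ I ∩ ⋂ i ∈ A, (I ∩ g i ⁻¹' ({0} : Set E)ᶜ) := by
    refine ⟨ht₀, Set.mem_iInter₂.2 fun i hi => ⟨ht₀, ?_⟩⟩
    exact (Finset.mem_filter.1 hi).2
  obtain ⟨ε, hε, hball⟩ := Metric.isOpen_iff.1 hUopen t₀ ht₀U
  refine ⟨t₀ - ε, t₀ + ε, by linarith, ?_, ?_⟩
  · intro t ht
    exact (hball (by rw [Real.ball_eq_Ioo]; exact ht)).1
  · intro i hi
    by_cases hiA : i ∈ A
    · right
      intro t ht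
      have := (Set.mem_iInter₂.1 (hball (by rw [Real.ball_eq_Ioo]; exact ht)).2) i hiA
      exact this.2
    · left
      intro t ht
      by_contra hgt
      have htI : t ∈ I := (hball (by rw [Real.ball_eq_Ioo]; exact ht)).1
      -- at `t` all of `A` and moreover `i` are non-vanishing: too many
      have hsub : insert i A ⊆ s.filter fun j => g j t ≠ 0 := by
        intro j hj
        rcases Finset.mem_insert.1 hj with rfl | hjA
        · exact Finset.mem_filter.2 ⟨hi, hgt⟩
        · have hjs : j ∈ s := (Finset.mem_filter.1 hjA).1
          have := (Set.mem_iInter₂.1 (hball (by rw [Real.ball_eq_Ioo]; exact ht)).2) j hjA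
          exact Finset.mem_filter.2 ⟨hjs, this.2⟩
      have h1 : (insert i A).card ≤ N t := Finset.card_le_card hsub
      have h2 : N t ≤ N t₀ := hmax t htI
      rw [Finset.card_insert_of_notMem hiA] at h1
      have : N t₀ = A.card := rfl
      omega


end KY

namespace KY.IsFiniteModeEulerSolution

open KY

variable {I : Set ℝ} {S : Finset (Fin 3 → ℝ)} {u : (Fin 3 → ℝ) → ℝ → (Fin 3 → ℂ)}

/-- The modes are continuous in time on `I`. [cite: KishimotoYoneda2022, §1 Def. 1.1] -/
theorem continuousOn (hS : IsFiniteModeEulerSolution I S u) (n : Fin 3 → ℝ) :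
    ContinuousOn (u n) I := by
  rw [continuousOn_pi]
  exact fun i => (hS.differentiableOn n i).continuousOn

/-- **A generic time interval.** For a finite-mode Euler solution and finitely many continuous
observables `Φ k` of a coefficient vector, there is a non-empty open interval `(c, d) ⊆ I` on
which every mode `u_n` (`n ∈ S`) and every `Φ k (u_n)` is either identically zero or nowhere
zero. This replaces "`t₀ ∈ I ∖ I₀`" ((1.6): `I₀` has no accumulation point by real analyticity).
[cite: KishimotoYoneda2022, §1 (1.6)] -/
theorem exists_generic_Ioo (hS : IsFiniteModeEulerSolution I S u) {κ E : Type*}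
    [TopologicalSpace E] [T1Space E] [Zero E] (K : Finset κ) (Φ : κ → (Fin 3 → ℂ) → E)
    (hΦ : ∀ k ∈ K, Continuous (Φ k)) :
    ∃ c d : ℝ, c < d ∧ Set.Ioo c d ⊆ I ∧
      (∀ n ∈ S, (∀ t ∈ Set.Ioo c d, u n t = 0) ∨ (∀ t ∈ Set.Ioo c d, u n t ≠ 0)) ∧
      (∀ q ∈ S ×ˢ K, (∀ t ∈ Set.Ioo c d, Φ q.2 (u q.1 t) = 0) ∨
        (∀ t ∈ Set.Ioo c d, Φ q.2 (u q.1 t) ≠ 0)) := by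
  obtain ⟨c, d, hcd, hsub, hgen⟩ := exists_Ioo_forall_eq_zero_or_ne_zero S hS.isOpen hS.nonempty
    (fun n t => u n t) (fun n _ => hS.continuousOn n)
  have hcont : ∀ q ∈ S ×ˢ K, ContinuousOn (fun t => Φ q.2 (u q.1 t)) (Set.Ioo c d) := by
    intro q hq
    exact ((hΦ q.2 (Finset.mem_product.1 hq).2).comp_continuousOn
      ((hS.continuousOn q.1).mono hsub))
  obtain ⟨c', d', hcd', hsub', hgen'⟩ := exists_Ioo_forall_eq_zero_or_ne_zero (S ×ˢ K) isOpen_Ioo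
    (Set.nonempty_Ioo.2 hcd) (fun q t => Φ q.2 (u q.1 t)) hcont
  refine ⟨c', d', hcd', hsub'.trans hsub, fun n hn => ?_, hgen'⟩
  rcases hgen n hn with h | h
  · exact Or.inl fun t ht => h t (hsub' ht)
  · exact Or.inr fun t ht => h t (hsub' ht)

/-- The time derivative of a mode vanishing on an open interval vanishes there. [folklore] -/
theorem deriv_eq_zero_of_eqOn_zero {c d : ℝ} {n : Fin 3 → ℝ} (h : ∀ t ∈ Set.Ioo c d, u n t = 0)
    {t : ℝ} (ht : t ∈ Set.Ioo c d) (i : Fin 3) : deriv (fun s => u n s i) t = 0 := by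
  have : (fun s => u n s i) =ᶠ[nhds t] fun _ => (0 : ℂ) := by
    filter_upwards [isOpen_Ioo.mem_nhds ht] with s hs
    rw [h s hs]; rfl
  rw [this.deriv_eq, deriv_const]

open scoped Classical in
/-- **Restriction to a generic interval.** On an interval `(c, d) ⊆ I` where each mode is either
identically zero or nowhere zero, the nowhere-zero modes `S₀ = {n ∈ S : u_n(t₀) ≠ 0}` together
with the zero-extended coefficients form a finite-mode Euler solution on `(c, d)` whose support is
exactly `S₀` at EVERY time ("the Fourier support of `u(t,·)` coincides with `S` if `t ∈ I ∖ I₀`").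
[cite: KishimotoYoneda2022, §1 Def. 1.1, (1.3), (1.6)] -/
theorem restrict (hS : IsFiniteModeEulerSolution I S u) {c d : ℝ} (hcd : c < d)
    (hsub : Set.Ioo c d ⊆ I)
    (hgen : ∀ n ∈ S, (∀ t ∈ Set.Ioo c d, u n t = 0) ∨ (∀ t ∈ Set.Ioo c d, u n t ≠ 0))
    {t₀ : ℝ} (ht₀ : t₀ ∈ Set.Ioo c d) :
    IsFiniteModeEulerSolution (Set.Ioo c d) (S.filter fun n => u n t₀ ≠ 0)
        (fun n t => if n ∈ S.filter (fun n => u n t₀ ≠ 0) then u n t else 0) ∧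
      (∀ n ∈ S.filter (fun n => u n t₀ ≠ 0), ∀ t ∈ Set.Ioo c d, u n t ≠ 0) ∧
      (∀ n ∈ S, n ∉ S.filter (fun n => u n t₀ ≠ 0) → ∀ t ∈ Set.Ioo c d, u n t = 0) := by
  set S₀ := S.filter fun n => u n t₀ ≠ 0 with hS₀
  have hmem : ∀ {n}, n ∈ S₀ ↔ n ∈ S ∧ u n t₀ ≠ 0 := fun {n} => by rw [hS₀, Finset.mem_filter]
  -- modes in `S₀` never vanish, the other occupied modes vanish identically on `(c, d)`
  have hnz : ∀ n ∈ S₀, ∀ t ∈ Set.Ioo c d, u n t ≠ 0 := by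
    intro n hn t ht
    obtain ⟨hnS, hn0⟩ := hmem.1 hn
    rcases hgen n hnS with h | h
    · exact absurd (h t₀ ht₀) hn0
    · exact h t ht
  have hz : ∀ n ∈ S, n ∉ S₀ → ∀ t ∈ Set.Ioo c d, u n t = 0 := by
    intro n hnS hn t ht
    rcases hgen n hnS with h | h
    · exact h t ht
    · exact absurd (hmem.2 ⟨hnS, h t₀ ht₀⟩) hn
  have hz' : ∀ n, n ∉ S₀ → ∀ t ∈ Set.Ioo c d, u n t = 0 := by
    intro n hn t ht
    by_cases hnS : n ∈ S
    · exact hz n hnS hn t ht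
    · exact hS.eq_zero_of_notMem n hnS t
  have hneg : ∀ {n}, n ∈ S₀ → -n ∈ S₀ := fun {n} hn => by
    obtain ⟨hnS, hn0⟩ := hmem.1 hn
    refine hmem.2 ⟨hS.neg_mem n hnS, ?_⟩
    rw [hS.conj]; simpa using hn0
  -- the nonlinearity of the restricted family is the original one on `(c, d)`
  have hnonlin : ∀ t ∈ Set.Ioo c d, ∀ m : Fin 3 → ℝ,
      nonlin S₀ (fun k => if k ∈ S₀ then u k t else 0) m = nonlin S (fun k => u k t) m := by
    intro t ht m
    rw [nonlin_eq_sum_bracket, nonlin_eq_sum_bracket]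
    congr 2
    apply Finset.sum_subset_zero_on_sdiff
    · intro q hq
      simp only [Finset.mem_filter, Finset.mem_product] at hq ⊢
      exact ⟨⟨(hmem.1 hq.1.1).1, (hmem.1 hq.1.2).1⟩, hq.2⟩
    · intro q hq
      simp only [Finset.mem_sdiff, Finset.mem_filter, Finset.mem_product, not_and] at hq
      obtain ⟨⟨-, h12⟩, hq'⟩ := hq
      by_cases hq1 : q.1 ∈ S₀
      · have hq2 : q.2 ∉ S₀ := fun h => hq' ⟨hq1, h⟩ h12
        rw [hz' q.2 hq2 t ht, bracket_zero_right]
      · rw [hz' q.1 hq1 t ht, bracket_zero_left]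
    · intro q hq
      simp only [Finset.mem_filter, Finset.mem_product] at hq
      simp only [hq.1.1, hq.1.2, if_true]
  refine ⟨?_, hnz, hz⟩
  exact
  { isOpen := isOpen_Ioo
    ordConnected := Set.ordConnected_Ioo
    nonempty := Set.nonempty_Ioo.2 hcd
    zero_notMem := fun h => hS.zero_notMem (hmem.1 h).1
    neg_mem := fun n hn => hneg hn
    eq_zero_of_notMem := fun n hn t => by simp [hn]
    exists_ne_zero := fun n hn => ⟨t₀, ht₀, by simp only [hn, if_true]; exact (hmem.1 hn).2⟩
    conj := fun n t => by
      by_cases hn : n ∈ S₀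
      · have : -n ∈ S₀ := hneg hn
        simp only [hn, this, if_true, hS.conj n t]
      · have : -n ∉ S₀ := fun h => hn (by simpa using hneg h)
        simp only [hn, this, if_false, star_zero]
    div_free := fun n hn t ht => by
      simpa [hn] using hS.div_free n (hmem.1 hn).1 t (hsub ht)
    differentiableOn := fun n i => by
      by_cases hn : n ∈ S₀
      · simpa [hn] using (hS.differentiableOn n i).mono hsub
      · simp only [hn, if_false]; exact differentiableOn_const (0 : ℂ)
    euler := fun n hn0 t ht i => by
      rw [hnonlin t ht]
      by_cases hn : n ∈ S₀
      · simpa [hn] using hS.euler n hn0 t (hsub ht) i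
      · simp only [hn, if_false]
        rw [deriv_const, zero_add]
        -- the original mode `n` vanishes identically near `t`, so its equation gives the claim
        have h := hS.euler n hn0 t (hsub ht) i
        rwa [deriv_eq_zero_of_eqOn_zero (hz' n hn) ht i, zero_add] at h }

end KY.IsFiniteModeEulerSolution

end Literature.Analysis.FluidPDE
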